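import Summits.CriticalPhenomena.Ising3DConformalLimit.Theorems.PerfectScreeningMixedSpectralRepresentation
import Summits.CriticalPhenomena.Ising3DConformalLimit.Theses.MirrorHoelderCompactness
import Summits.CriticalPhenomena.Ising3DConformalLimit.Theses.UnitLightCone
import HarnessLib

/-!
# Strategist sketch (cstrat s1, instance UnitLightCone) — SPECTRAL-SIDE forms of the compactness child of crux 1981

Typed statements for the census `STRATEGY-CENSUS-s1-instULC.md` (§Transfer-spectral / §Strengthen). Nothing here is a line or a
stub; these are the S⁺ / transfer targets the census evaluates, elaborated so that they are not prose.

* `AxisHausdorffMoment μ` — `μ` is a representing (Hausdorff-moment / transfer-matrix spectral) measure of the AXIS critical two-point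
  function `g(n) = ⟨σ₀σ_{n e₀}⟩_{β_c(3)}`: exists by the landed `mixedSpectralRepresentation_proof` (ADC21 Prop. 5.3 / 8.6) with `s = {0}`,
  `v = 1` (there the site is written `Fin.cons n 0`; `Fin.cons (n:ℤ) 0 = Pi.single 0 n`).
* `SpectralEdgeDoubling` — the spectral measure of `σ₀` is a DOUBLING MEASURE AT THE TOP OF THE SPECTRUM: `U(2y) ≤ K·U(y)` for small `y`, where
  `U(y) = μ[e^{-y}, 1]` is the spectral distribution function in the gap variable `y = −log λ`. Claimed (pen-and-paper, census §Strengthen-spectral):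
  `SpectralEdgeDoubling ⟺ TwoPointDoubling` (item 6150) by the O-regular-variation Tauberian theorem for Laplace–Stieltjes transforms
  (de Haan–Stadtmüller 1985; Bingham–Goldie–Teugels §2.10), since `g(n) = ∫ e^{-n y} dU(y)` and `g` is non-increasing.
* `LightConeSaturatedEpisodes` — the negation-side observation typed as a statement about abstract data: every completely monotone sequence with an
  absolutely continuous representing density is the `x_⊥ = 0` section of a mixed spectral measure carried EXACTLY by a unit light cone
  `λ = e^{-|k|}`; hence lattice unit speed (the route's (US) in its lattice reading) does not exclude episodic axis profiles.
-/

noncomputable section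

open MeasureTheory Set Filter Real
open scoped Topology

namespace Summit.CriticalPhenomena.Ising3DConformalLimit.Cruxes.ExistsScaleCovariantLimit.StrategistS1ULC

open Literature.Probability.LatticeModels

/-- `μ` represents the axis critical two-point function as a Hausdorff moment sequence on `[0,1]`. -/
def AxisHausdorffMoment (μ : Measure ℝ) : Prop :=
  IsFiniteMeasure μ ∧ μ (Icc (0:ℝ) 1)ᶜ = 0 ∧
    ∀ n : ℕ, criticalTwoPoint 3 (Pi.single 0 (n : ℤ)) = ∫ t, t ^ n ∂μ

/-- **S⁺_spec (SpectralEdgeDoubling).** Every representing measure of the axis function is doubling at the spectral edge `λ = 1`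
(gap variable `y = -log λ`): `μ[e^{-2y},1] ≤ K μ[e^{-y},1]` for `0 < y ≤ y₀`. -/
def SpectralEdgeDoubling : Prop :=
  ∀ μ : Measure ℝ, AxisHausdorffMoment μ →
    ∃ K y₀ : ℝ, 0 < K ∧ 0 < y₀ ∧ ∀ y ∈ Ioc (0:ℝ) y₀,
      μ.real (Icc (Real.exp (-(2 * y))) 1) ≤ K * μ.real (Icc (Real.exp (-y)) 1)

/-- The Tauberian dictionary this pass claims on paper (NOT proved here; census §Strengthen-spectral):
spectral-edge doubling ⟺ item 6150. Stated as a `Prop` so that a prover/refuter can pick it up. -/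
def SpectralEdgeDoublingIffTwoPointDoubling : Prop :=
  SpectralEdgeDoubling ↔ Summit.CriticalPhenomena.Ising3DConformalLimit.Theses.MirrorHoelderCompactness.TwoPointDoubling

/-- **Light-cone saturation (negation side, abstract).** Any sequence `a n = ∫₀^∞ e^{-n y} u(y) dy` with a nonnegative integrable density `u`
is the transverse-origin section of a "mixed spectral measure" carried exactly by the unit light cone `{(λ,k) : λ = e^{-‖k‖}}` of `[0,1] × ℝ²`:
there is a finite measure `ρ` on `ℝ × EuclideanSpace ℝ (Fin 2)` with `ρ {p | p.1 ≠ Real.exp (-‖p.2‖)} = 0` and `a n = ∫ p, p.1 ^ n ∂ρ`.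
(Proof sketch: push `u(y) dy ⊗ (uniform on the circle ‖k‖ = y)` forward along `y ↦ (e^{-y}, k)`.) Consequence recorded in the census: the
route's own lattice unit-speed input (US) cannot separate episodic axis profiles (c14's fat family, all with a.c. densities) from doubling ones. -/
def LightConeSaturatedEpisodes : Prop :=
  ∀ u : ℝ → ℝ, (∀ y, 0 ≤ u y) → IntegrableOn u (Ioi 0) →
    ∃ ρ : Measure (ℝ × EuclideanSpace ℝ (Fin 2)), IsFiniteMeasure ρ ∧
      ρ {p | p.1 ≠ Real.exp (-‖p.2‖)} = 0 ∧
        ∀ n : ℕ, ∫ y in Ioi 0, Real.exp (-(n * y)) * u y = ∫ p, p.1 ^ n ∂ρ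

/-- Sanity: the representing measure of the axis function EXISTS (landed ADC21 Prop 5.3, `s = {0}`, `v = 1`), so `SpectralEdgeDoubling`
quantifies over a nonempty family and is not vacuous. -/
theorem exists_axisHausdorffMoment : ∃ μ : Measure ℝ, AxisHausdorffMoment μ := by
  obtain ⟨μ, hfin, hsupp, hmom⟩ :=
    Summit.CriticalPhenomena.Ising3DConformalLimit.Theorems.mixedSpectralRepresentation_proof {0} (fun _ => 1)
  refine ⟨μ, hfin, hsupp, fun n => ?_⟩
  have h := hmom (n : ℤ)
  simp only [Finset.sum_singleton, sub_self, one_mul, Int.natAbs_natCast] at h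
  -- `Fin.cons (n:ℤ) 0 = Pi.single 0 n` as sites of `ℤ³`
  have hsite : (Fin.cons (n : ℤ) (0 : Fin 2 → ℤ) : Fin 3 → ℤ) = Pi.single 0 (n : ℤ) := by
    funext i
    refine Fin.cases ?_ (fun j => ?_) i
    · simp
    · simp [Fin.cons_succ, Fin.succ_ne_zero]
  rw [hsite] at h
  exact h

end Summit.CriticalPhenomena.Ising3DConformalLimit.Cruxes.ExistsScaleCovariantLimit.StrategistS1ULC

end
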